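import Literature.Geometry.Riemannian.ConjugatePointsExp
import Literature.Geometry.Riemannian.CartanHadamardConjugate
import Literature.Geometry.Riemannian.ConstantCurvature
import Literature.Geometry.Riemannian.HopfRinowCompact
import HarnessLib

/-!
# Jacobi fields in constant curvature `1`: the norm of `d(exp_p)_v` (Cartan's lemma)
(topic `Geometry/Riemannian`)

Lee, *Introduction to Riemannian Manifolds*, 2nd ed. (2018), Prop. 10.12: in a Riemannian
manifold of constant sectional curvature `c`, the Jacobi field along a unit speed geodesic `γ`
with `J(0) = 0`, `D_tJ(0) = w ⊥ γ'` is `J(t) = s_c(t) E(t)` with `E` parallel (`s_1 = sin`);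
together with Prop. 10.10 (`J(t) = d(exp_p)_{tv}(tw)`) this computes the metric in normal
coordinates, i.e. the pullback `exp_p^* g`, purely in terms of `g_p` — the local content of the
theorems of Cartan and Killing–Hopf (Lee Thm. 10.14 ff., Thm. 12.4; do Carmo, *Riemannian
Geometry*, Ch. 8, Thm. 2.1 (Cartan) and Thm. 4.1). This file proves, for a `C^n` (`n ≥ 1`)
positive definite metric `g` whose Levi-Civita connection is locally `C¹`, `C^∞` and geodesically
complete, with `(g, ∇)` of constant sectional curvature `1` (`HasConstantSectionalCurvatureWith`,
`ConstantCurvature.lean`), for `v ≠ 0` in `T_pM` with `λ = g(v, v)`: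

* `val_mfderiv_expMap_self_of_curvature_one` —
  `|d(exp_p)_v(w)|² = g(w,v)²/λ + (g(w,w) - g(w,v)²/λ) · sin²(√λ)/λ`;
* `val_mfderiv_expMap_of_curvature_one` — the polarised identity for `g(d(exp_p)_v w, d(exp_p)_v w')`;
* `val_mfderiv_expMap_zero` — at `v = 0`, `d(exp_p)_0 = id`;
* `mfderiv_expMap_injective_of_curvature_one` — for `g(v,v) < π²`, `d(exp_p)_v` is injective
  (no conjugate points before distance `π`).

Proof (not through parallel frames, which the tree does not have along curves, but through the
scalar invariants): with the geodesic variation `Γ(t,s) = γ_{v+sw}(t)` of `JacobiVariation.lean`,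
`S = ∂_sΓ(·,0)` (`S(t) = d(exp_p)_{tv}(tw)`, `S(0) = 0`, `D_tS(0) = w`), `T = γ_v'` and the Jacobi
equation `D_tD_tS = -R(S,T)T = -(g(T,T)S - g(S,T)T)` (constant curvature `1`), the five functions
`a = g(S,T)`, `b = g(D_tS,T)`, `f = |S|²`, `h = g(D_tS,S)`, `k = |D_tS|²` satisfy, by metric
compatibility along `γ_v` (`hasDerivAt_val_apply_along`), the closed system
`a' = b, b' = 0, f' = 2h, h' = -λf + a² + k, k' = -2(λh - ab)`, whose solution with the given
initial data has `f(t) = (bt)²/λ + ((k₀ - b²/λ)/λ) sin²(√λ t)` (`jacobi_scalar_system`, elementary: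
`K + λF` is conserved for the reduced unknowns and an energy argument identifies `(F, H)`).
The template is `CartanHadamardConjugate.lean` (same fields, `K ≤ 0` there).

No definitions, no named facts (D-0026). These are the `M`-side inputs of the Killing–Hopf
theorem for positive curvature (hypothesis (H2) of `HamiltonPCOClassificationProofs.lean`).

## References

* J. M. Lee, *Introduction to Riemannian Manifolds*, 2nd ed., GTM 176, Springer (2018):
  Prop. 5.19, Prop. 10.10, Prop. 10.12, Prop. 10.20, Thm. 10.14, Thm. 12.4. [Lee2018]
* M. P. do Carmo, *Riemannian Geometry*, Birkhäuser (1992), Ch. 5 §2 (Jacobi fields on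
  manifolds of constant curvature), Ch. 8, Thm. 2.1 (Cartan), Thm. 4.1. [doCarmo1992]
* B. O'Neill, *Semi-Riemannian geometry* (1983), Ch. 8, Lemma 3; Ch. 3, Prop. 18. [ONeill1983]
-/

noncomputable section

open Bundle Set Filter Function
open scoped Manifold ContDiff Topology

namespace Literature.Geometry.Riemannian

/-! ### The scalar system -/

section Scalar

/-- **The scalar system of the Jacobi norms in constant curvature.** Along a geodesic with
`λ = |γ'|² > 0` in a space of constant curvature `1`, the functions `a = g(J, γ')`,
`b = g(J', γ')`, `f = |J|²`, `h = g(J', J)`, `k = |J'|²` of a Jacobi field `J` with `J(0) = 0`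
satisfy `a' = b`, `b' = 0`, `f' = 2h`, `h' = -λ f + a² + k`, `k' = -2(λ h - a b)`; then
`f(t) = (b₀ t)²/λ + ((k₀ - b₀²/λ)/λ) sin²(√λ t)`. Proof: `b` is constant and `a` linear; the
reduced unknowns `F = f - a²/λ`, `H = h - ab/λ`, `K = k - b²/λ` satisfy `F' = 2H`,
`H' = -λF + K`, `K' = -2λH`, so `K + λF` is conserved and `(F, H)` solves a linear system whose
energy `λ(F - F₀)² + (H - H₀)²` relative to the explicit solution
`F₀ = (μ/λ) sin²(√λ t)`, `H₀ = (μ/√λ) sin cos` is conserved, `= 0`. Elementary calculus; this is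
the computation behind Lee 2018, Prop. 10.12 (Jacobi fields in constant curvature,
`J(t) = k s_c(t) E(t)`). [cite: Lee2018, Prop. 10.12] -/
theorem jacobi_scalar_system {a b f h k : ℝ → ℝ} {lam : ℝ} (hlam : 0 < lam)
    (ha : ∀ t, HasDerivAt a (b t) t) (hb : ∀ t, HasDerivAt b 0 t)
    (hf : ∀ t, HasDerivAt f (2 * h t) t)
    (hh : ∀ t, HasDerivAt h (-lam * f t + a t ^ 2 + k t) t)
    (hk : ∀ t, HasDerivAt k (-2 * (lam * h t - a t * b t)) t)
    (ha0 : a 0 = 0) (hf0 : f 0 = 0) (hh0 : h 0 = 0) (t : ℝ) :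
    f t = (b 0 * t) ^ 2 / lam +
      (k 0 - b 0 ^ 2 / lam) / lam * Real.sin (Real.sqrt lam * t) ^ 2 := by
  -- write `lam = ρ²`
  obtain ⟨ρ, hρpos, rfl⟩ : ∃ ρ : ℝ, 0 < ρ ∧ ρ ^ 2 = lam :=
    ⟨Real.sqrt lam, Real.sqrt_pos.2 hlam, Real.sq_sqrt hlam.le⟩
  rw [Real.sqrt_sq hρpos.le]
  have hρ0 : ρ ≠ 0 := hρpos.ne'
  have hlam0 : ρ ^ 2 ≠ 0 := pow_ne_zero 2 hρ0
  set β : ℝ := b 0 with hβ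
  set μ : ℝ := k 0 - β ^ 2 / ρ ^ 2 with hμ
  clear_value μ
  -- `b` is constant, `a` is linear
  have hbc : ∀ t, b t = β := fun t ↦
    is_const_of_deriv_eq_zero (fun t ↦ (hb t).differentiableAt) (fun t ↦ (hb t).deriv) t 0
  have hac : ∀ t, a t = β * t := fun t ↦ by
    have h1 : ∀ s, HasDerivAt (fun s ↦ a s - β * s) 0 s := fun s ↦ by
      have h := (ha s).sub ((hasDerivAt_id' s).const_mul β)
      rw [hbc s, mul_one, sub_self] at h
      exact h
    have h2 := is_const_of_deriv_eq_zero (fun s ↦ (h1 s).differentiableAt)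
      (fun s ↦ (h1 s).deriv) t 0
    simp only [ha0, mul_zero, sub_zero] at h2
    linarith
  -- the reduced unknowns `F = f - a²/λ`, `H = h - a b/λ`, `K = k - b²/λ`
  set F : ℝ → ℝ := fun t ↦ f t - a t ^ 2 / ρ ^ 2 with hF
  set H : ℝ → ℝ := fun t ↦ h t - a t * b t / ρ ^ 2 with hH
  set K : ℝ → ℝ := fun t ↦ k t - b t ^ 2 / ρ ^ 2 with hK
  have hFd : ∀ t, HasDerivAt F (2 * H t) t := fun t ↦ by
    refine ((hf t).sub (((ha t).pow 2).div_const (ρ ^ 2))).congr_deriv ?_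
    simp only [hH]
    field_simp
    ring
  have hHd : ∀ t, HasDerivAt H (-ρ ^ 2 * F t + K t) t := fun t ↦ by
    refine ((hh t).sub (((ha t).mul (hb t)).div_const (ρ ^ 2))).congr_deriv ?_
    simp only [hF, hK]
    field_simp
    ring
  have hKd : ∀ t, HasDerivAt K (-2 * ρ ^ 2 * H t) t := fun t ↦ by
    refine ((hk t).sub (((hb t).pow 2).div_const (ρ ^ 2))).congr_deriv ?_
    simp only [hH]
    field_simp
    ring
  -- the conservation law `K + λ F = μ`
  have hcons : ∀ t, K t + ρ ^ 2 * F t = μ := fun t ↦ by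
    have h1 : ∀ s, HasDerivAt (fun s ↦ K s + ρ ^ 2 * F s) 0 s := fun s ↦ by
      refine ((hKd s).add ((hFd s).const_mul (ρ ^ 2))).congr_deriv ?_
      ring
    have h2 := is_const_of_deriv_eq_zero (fun s ↦ (h1 s).differentiableAt)
      (fun s ↦ (h1 s).deriv) t 0
    rw [h2]
    simp only [hK, hF, hf0, ha0, hμ]
    ring
  -- the explicit solution and the energy of the difference
  set F₀ : ℝ → ℝ := fun t ↦ μ / ρ ^ 2 * Real.sin (ρ * t) ^ 2 with hF₀
  set H₀ : ℝ → ℝ := fun t ↦ μ / ρ * (Real.sin (ρ * t) * Real.cos (ρ * t)) with hH₀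
  have hs : ∀ t, HasDerivAt (fun t ↦ Real.sin (ρ * t)) (Real.cos (ρ * t) * ρ) t := fun t ↦ by
    simpa using ((hasDerivAt_id' t).const_mul ρ).sin
  have hc : ∀ t, HasDerivAt (fun t ↦ Real.cos (ρ * t)) (-Real.sin (ρ * t) * ρ) t := fun t ↦ by
    simpa using ((hasDerivAt_id' t).const_mul ρ).cos
  have hF₀d : ∀ t, HasDerivAt F₀ (2 * H₀ t) t := fun t ↦ by
    refine (((hs t).pow 2).const_mul (μ / ρ ^ 2)).congr_deriv ?_
    simp only [hH₀]
    field_simp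
    ring
  have hH₀d : ∀ t, HasDerivAt H₀ (μ - 2 * ρ ^ 2 * F₀ t) t := fun t ↦ by
    refine (((hs t).mul (hc t)).const_mul (μ / ρ)).congr_deriv ?_
    simp only [hF₀]
    have hsc : Real.sin (ρ * t) ^ 2 + Real.cos (ρ * t) ^ 2 = 1 := Real.sin_sq_add_cos_sq _
    field_simp
    linear_combination μ * hsc
  set Φ : ℝ → ℝ := fun t ↦ ρ ^ 2 * (F t - F₀ t) ^ 2 + (H t - H₀ t) ^ 2 with hΦ
  have hΦd : ∀ t, HasDerivAt Φ 0 t := fun t ↦ by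
    have h1 := (((((hFd t).sub (hF₀d t)).pow 2).const_mul (ρ ^ 2)).add
      (((hHd t).sub (hH₀d t)).pow 2))
    have hKt : K t = μ - ρ ^ 2 * F t := by linarith [hcons t]
    refine h1.congr_deriv ?_
    rw [hKt]
    simp only [Nat.cast_ofNat, Pi.sub_apply]
    ring
  have hΦc : ∀ t, Φ t = Φ 0 := fun t ↦
    is_const_of_deriv_eq_zero (fun t ↦ (hΦd t).differentiableAt) (fun t ↦ (hΦd t).deriv) t 0
  have hΦ0 : Φ 0 = 0 := by
    simp only [hΦ, hF, hH, hF₀, hH₀, hf0, ha0, hh0, mul_zero, Real.sin_zero]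
    ring
  have hFt : F t = F₀ t := by
    have h1 := hΦc t
    rw [hΦ0] at h1
    simp only [hΦ] at h1
    have h2 : ρ ^ 2 * (F t - F₀ t) ^ 2 = 0 := by
      nlinarith [sq_nonneg (F t - F₀ t), sq_nonneg (H t - H₀ t),
        mul_nonneg (sq_nonneg ρ) (sq_nonneg (F t - F₀ t))]
    have h3 : (F t - F₀ t) ^ 2 = 0 := (mul_eq_zero.1 h2).resolve_left hlam0
    nlinarith [sq_nonneg (F t - F₀ t)]
  -- conclude
  have : f t = a t ^ 2 / ρ ^ 2 + F t := by simp only [hF]; ring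
  rw [this, hFt, hac t]
end Scalar

/-! ### The geometric computation -/

section Geometry

open Literature.Geometry.Lorentzian
open Literature.Geometry.Lorentzian.PseudoRiemannianMetric

variable {E : Type*} [NormedAddCommGroup E] [NormedSpace ℝ E] {H : Type*} [TopologicalSpace H]
  {I : ModelWithCorners ℝ E H} {M : Type*} [TopologicalSpace M] [ChartedSpace H M]
  [IsManifold I ∞ M] {n : ℕ∞ω}
  {g : PseudoRiemannianMetric I n E (TangentSpace I : M → Type _)}

variable [Fact (1 ≤ n)] [FiniteDimensional ℝ E] [CompleteSpace E] [T2Space M] [I.Boundaryless]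
  [g.HasLeviCivita]
  [CovariantDerivative.ContMDiffCovariantDerivative g.leviCivita 1]
  [CovariantDerivative.ContMDiffCovariantDerivative g.leviCivita ∞]

omit [Fact (1 ≤ n)] [FiniteDimensional ℝ E] [CompleteSpace E] [T2Space M] [I.Boundaryless]
  [g.HasLeviCivita]
  [CovariantDerivative.ContMDiffCovariantDerivative g.leviCivita 1]
  [CovariantDerivative.ContMDiffCovariantDerivative g.leviCivita ∞] in
/-- The metric at equal points, on the same model vectors (a cross-fibre rewriting). [folklore] -/
theorem val_congr_point {x y : M} (h : x = y) (u u' : E) :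
    g.val x (show TangentSpace I x from u) (show TangentSpace I x from u') =
      g.val y (show TangentSpace I y from u) (show TangentSpace I y from u') := by
  subst h; rfl

/-- **The norm of the differential of the exponential map in constant curvature `1`** (Cartan;
Lee 2018, Prop. 10.12 with Prop. 10.10: in constant curvature `c` the Jacobi field along the
geodesic `γ_v` with `J(0) = 0`, `D_tJ(0) = w` is `t g(w,v̂) γ̂' + s_c · E` with `E` parallel
normal, so for `c = 1`, `|v|² = λ`:
`|d(exp_p)_v(w)|² = |J(1)|² = g(w,v)²/λ + (g(w,w) - g(w,v)²/λ) sin²(√λ)/λ`).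
Hypotheses: `g` positive definite of class `C^n`, `n ≥ 1`, with Levi-Civita connection locally
`C¹`, `C^∞` and geodesically complete, and `(g, ∇)` of constant sectional curvature `1`
(`HasConstantSectionalCurvatureWith`); `v ≠ 0`. Proof: the five scalar functions
`g(S,T), g(D_tS,T), g(S,S), g(D_tS,S), g(D_tS,D_tS)` of the variation field `S(t) = d(exp_p)_{tv}(tw)`
along `γ_v` (a Jacobi field, `jacobi_geodesicVariation`, with `S(0) = 0`, `D_tS(0) = w`) satisfy
the system of `jacobi_scalar_system` by metric compatibility (`hasDerivAt_val_apply_along`) and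
`R(S,T)T = g(T,T)S - g(S,T)T`. [cite: Lee2018, Prop. 10.12] -/
theorem val_mfderiv_expMap_self_of_curvature_one (hg : g.IsRiemannian)
    (hK : g.HasConstantSectionalCurvatureWith g.leviCivita 1)
    (hcov₁ : g.leviCivita.IsLocallyContMDiff 1)
    (hc : IsGeodesicallyComplete g.leviCivita) (p : M) {v : E} (hv : v ≠ 0) (w : E) :
    g.val (expMap g.leviCivita p (show TangentSpace I p from v))
        (mfderiv 𝓘(ℝ, E) I (fun u : E ↦ expMap g.leviCivita p (show TangentSpace I p from u)) v w)
        (mfderiv 𝓘(ℝ, E) I (fun u : E ↦ expMap g.leviCivita p (show TangentSpace I p from u)) v w) =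
      (g.val p (show TangentSpace I p from w) (show TangentSpace I p from v)) ^ 2 /
          g.val p (show TangentSpace I p from v) (show TangentSpace I p from v) +
        (g.val p (show TangentSpace I p from w) (show TangentSpace I p from w) -
            (g.val p (show TangentSpace I p from w) (show TangentSpace I p from v)) ^ 2 /
              g.val p (show TangentSpace I p from v) (show TangentSpace I p from v)) /
          g.val p (show TangentSpace I p from v) (show TangentSpace I p from v) *
        Real.sin (Real.sqrt (g.val p (show TangentSpace I p from v)
          (show TangentSpace I p from v))) ^ 2 := by
  have hLC := isLeviCivita_leviCivita_holds (g := g)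
  have htors : g.leviCivita.torsion = 0 := hLC.1
  have hcompat : g.IsCompatible g.leviCivita := hLC.2
  have h2 : (2 : ℕ∞ω) ≤ ∞ := WithTop.coe_le_coe.2 le_top
  -- the vectors read in `T_pM` and the geodesic variation `X t s = γ_{v + s w}(t)`
  let vT : TangentSpace I p := v
  let wT : TangentSpace I p := w
  set X : ℝ → ℝ → M := fun t s ↦ maximalGeodesic g.leviCivita p (vT + s • wT) t with hX_def
  have hXs : ContMDiff (𝓘(ℝ, ℝ).prod 𝓘(ℝ, ℝ)) I ∞ (uncurry X) :=
    contMDiff_uncurry_geodesicVariation hc p vT wT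
  have hX2 : ∀ q : ℝ × ℝ, ContMDiffAt (𝓘(ℝ, ℝ).prod 𝓘(ℝ, ℝ)) I 2 (uncurry X) q :=
    fun q ↦ (hXs q).of_le h2
  -- the curve `γ = X(·, 0)`, the fields `S = ∂_s X(·, 0)`, `T = ∂_t X(·, 0)`, `DS = D_t S`
  set γ : ℝ → M := fun t ↦ X t 0 with hγ_def
  set S : Π t : ℝ, TangentSpace I (γ t) := fun t ↦ velocity I (X t) 0 with hS_def
  set T : Π t : ℝ, TangentSpace I (γ t) := fun t ↦ velocity I γ t with hT_def
  set DS : Π t : ℝ, TangentSpace I (γ t) := fun t ↦ covariantDerivAlong g.leviCivita γ S t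
    with hDS_def
  set DDS : Π t : ℝ, TangentSpace I (γ t) := fun t ↦ covariantDerivAlong g.leviCivita γ DS t
    with hDDS_def
  -- `γ` is the geodesic `γ_v`
  have hγgeo : IsGeodesic g.leviCivita γ := (isGeodesic_maximalGeodesic hc p (vT + (0 : ℝ) • wT)).1
  have hγ0 : γ 0 = p := (isGeodesic_maximalGeodesic hc p (vT + (0 : ℝ) • wT)).2.1
  have hT0 : T 0 = v := by
    have h := (isGeodesic_maximalGeodesic hc p (vT + (0 : ℝ) • wT)).2.2
    refine (show T 0 = vT + (0 : ℝ) • wT from h).trans ?_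
    rw [zero_smul, add_zero]
  have hDT : ∀ t, covariantDerivAlong g.leviCivita γ T t = 0 := fun t ↦ hγgeo.2 t (mem_univ t)
  -- the Jacobi equation `D_t D_t S = -R(S, T) T`
  have hjac : ∀ t₀ : ℝ, DDS t₀ + g.leviCivita.curvature (γ t₀) (S t₀) (T t₀) (T t₀) = 0 :=
    fun t₀ ↦ jacobi_geodesicVariation hcov₁ htors hc p vT wT 0 t₀
  -- differentiability of the lifts of `S`, `T`, `DS`
  have hSl : ContMDiff 𝓘(ℝ, ℝ) I.tangent ∞
      (fun t ↦ (TotalSpace.mk' E (γ t) (S t) : TangentBundle I M)) :=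
    contMDiff_lift_velocity_geodesicVariation hc p vT wT 0
  have hS : ∀ t, MDifferentiableAt 𝓘(ℝ, ℝ) I.tangent
      (fun t ↦ (TotalSpace.mk' E (γ t) (S t) : TangentBundle I M)) t :=
    fun t ↦ (hSl t).mdifferentiableAt (by simp)
  have hT : ∀ t, MDifferentiableAt 𝓘(ℝ, ℝ) I.tangent
      (fun t ↦ (TotalSpace.mk' E (γ t) (T t) : TangentBundle I M)) t :=
    fun t ↦ hγgeo.1 t (mem_univ t)
  have hT2 : ∀ q : ℝ × ℝ, ContMDiffAt (𝓘(ℝ, ℝ).prod 𝓘(ℝ, ℝ)) I.tangent 2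
      (fun q : ℝ × ℝ ↦ (TotalSpace.mk' E (X q.1 q.2) (velocity I (fun t' ↦ X t' q.2) q.1) :
        TangentBundle I M)) q :=
    fun q ↦ ((contMDiff_tangentLift_geodesicVariation hc p vT wT) q).of_le h2
  have hsymm : ∀ t, covariantDerivAlong g.leviCivita γ S t =
      covariantDerivAlong g.leviCivita (X t) (fun s ↦ velocity I (fun t' ↦ X t' s) t) 0 :=
    fun t ↦ covariantDerivAlong_velocity_comm g.leviCivita htors (hX2 (t, 0))
  have hDsT : ∀ t, MDifferentiableAt 𝓘(ℝ, ℝ) I.tangent (fun t' ↦ (TotalSpace.mk' E (X t' 0)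
      (covariantDerivAlong g.leviCivita (X t') (fun s ↦ velocity I (fun t'' ↦ X t'' s) t') 0) :
        TangentBundle I M)) t :=
    fun t ↦ mdifferentiableAt_lift_covariantDerivAlong_curry_right g.leviCivita hcov₁
      (hX2 (t, 0)) (hT2 (t, 0))
  have hDS : ∀ t, MDifferentiableAt 𝓘(ℝ, ℝ) I.tangent
      (fun t' ↦ (TotalSpace.mk' E (γ t') (DS t') : TangentBundle I M)) t := by
    intro t
    have heq : (fun t' ↦ (TotalSpace.mk' E (γ t') (DS t') : TangentBundle I M)) =
        fun t' ↦ (TotalSpace.mk' E (X t' 0) (covariantDerivAlong g.leviCivita (X t')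
          (fun s ↦ velocity I (fun t'' ↦ X t'' s) t') 0) : TangentBundle I M) := by
      funext t'
      show (TotalSpace.mk' E (X t' 0) (covariantDerivAlong g.leviCivita γ S t') :
          TangentBundle I M) = _
      rw [TotalSpace.mk_inj]
      exact hsymm t'
    rw [heq]
    exact hDsT t
  -- the constant `λ = g(T, T) = g(v, v) > 0`
  set lam : ℝ := g.val p (show TangentSpace I p from v) (show TangentSpace I p from v) with hlam
  have hlampos : 0 < lam := hg p _ hv
  have hTT : ∀ t, g.val (γ t) (T t) (T t) = lam := by
    intro t
    have h := val_velocity_maximalGeodesic hc p (vT + (0 : ℝ) • wT) t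
    refine (show g.val (γ t) (T t) (T t) = g.val p (vT + (0 : ℝ) • wT) (vT + (0 : ℝ) • wT)
      from h).trans ?_
    rw [zero_smul, add_zero]
  -- the curvature terms: `g(D_tD_tS, Z) = -(g(T,T) g(S,Z) - g(S,T) g(T,Z))`
  have hcurv : ∀ t (Z : TangentSpace I (γ t)), g.val (γ t) (DDS t) Z =
      -(lam * g.val (γ t) (S t) Z - g.val (γ t) (S t) (T t) * g.val (γ t) (T t) Z) := by
    intro t Z
    have h1 : DDS t = -g.leviCivita.curvature (γ t) (S t) (T t) (T t) :=
      eq_neg_of_add_eq_zero_left (hjac t)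
    have h3 : g.val (γ t) (DDS t) Z = -g.curvatureForm g.leviCivita (γ t) (S t) (T t) (T t) Z := by
      rw [h1, map_neg]
      rfl
    rw [h3, hK.curvatureForm_eq, hTT t, one_mul]
  -- the five scalar functions and their derivatives
  have ha : ∀ t, HasDerivAt (fun t ↦ g.val (γ t) (S t) (T t)) (g.val (γ t) (DS t) (T t)) t := by
    intro t
    have h := hasDerivAt_val_apply_along (g := g) hcompat (hS t) (hT t)
    rw [hDT t, map_zero, add_zero] at h
    exact h
  have hb : ∀ t, HasDerivAt (fun t ↦ g.val (γ t) (DS t) (T t)) 0 t := by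
    intro t
    have h := hasDerivAt_val_apply_along (g := g) hcompat (hDS t) (hT t)
    rw [hDT t, map_zero, add_zero] at h
    refine h.congr_deriv ?_
    show g.val (γ t) (DDS t) (T t) = 0
    rw [hcurv t (T t), hTT t, g.symm (γ t) (S t) (T t)]
    ring
  have hf : ∀ t, HasDerivAt (fun t ↦ g.val (γ t) (S t) (S t))
      (2 * g.val (γ t) (DS t) (S t)) t := by
    intro t
    have h := hasDerivAt_val_apply_along (g := g) hcompat (hS t) (hS t)
    refine h.congr_deriv ?_
    rw [g.symm (γ t) (S t) (DS t)]
    ring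
  have hh : ∀ t, HasDerivAt (fun t ↦ g.val (γ t) (DS t) (S t))
      (-lam * g.val (γ t) (S t) (S t) + g.val (γ t) (S t) (T t) ^ 2 +
        g.val (γ t) (DS t) (DS t)) t := by
    intro t
    have h := hasDerivAt_val_apply_along (g := g) hcompat (hDS t) (hS t)
    refine h.congr_deriv ?_
    show g.val (γ t) (DDS t) (S t) + g.val (γ t) (DS t) (DS t) = _
    rw [hcurv t (S t), g.symm (γ t) (T t) (S t)]
    ring
  have hk : ∀ t, HasDerivAt (fun t ↦ g.val (γ t) (DS t) (DS t))
      (-2 * (lam * g.val (γ t) (DS t) (S t) -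
        g.val (γ t) (S t) (T t) * g.val (γ t) (DS t) (T t))) t := by
    intro t
    have h := hasDerivAt_val_apply_along (g := g) hcompat (hDS t) (hDS t)
    refine h.congr_deriv ?_
    show g.val (γ t) (DDS t) (DS t) + g.val (γ t) (DS t) (DDS t) = _
    rw [g.symm (γ t) (DS t) (DDS t), hcurv t (DS t), g.symm (γ t) (S t) (DS t),
      g.symm (γ t) (T t) (DS t)]
    ring
  -- initial values
  have hS0 : S 0 = 0 := velocity_geodesicVariation_zero hc p vT wT 0
  have hDS0 : DS 0 = w := covariantDerivAlong_velocity_geodesicVariation_zero htors hc p vT wT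
  have ha0 : g.val (γ 0) (S 0) (T 0) = 0 := by rw [hS0, map_zero]; rfl
  have hf0 : g.val (γ 0) (S 0) (S 0) = 0 := by rw [hS0, map_zero]
  have hh0 : g.val (γ 0) (DS 0) (S 0) = 0 := by rw [hS0, map_zero]
  have hb0 : g.val (γ 0) (DS 0) (T 0) = g.val p (show TangentSpace I p from w)
      (show TangentSpace I p from v) := by
    rw [hDS0, hT0]
    exact val_congr_point (g := g) hγ0 w v
  have hk0 : g.val (γ 0) (DS 0) (DS 0) = g.val p (show TangentSpace I p from w)
      (show TangentSpace I p from w) := by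
    rw [hDS0]
    exact val_congr_point (g := g) hγ0 w w
  -- solve the system
  have key := jacobi_scalar_system hlampos ha hb hf hh hk ha0 hf0 hh0 1
  rw [hb0, hk0, mul_one, mul_one] at key
  -- `S 1 = d(exp_p)_v(w)` and `γ 1 = exp_p v`
  have hS1 : S 1 = mfderiv 𝓘(ℝ, E) I
      (fun u : E ↦ expMap g.leviCivita p (show TangentSpace I p from u)) v w := by
    have h := velocity_geodesicVariation_eq_mfderiv_expMap hc p vT wT 1
    rw [one_smul, one_smul] at h
    exact h
  have hγ1 : γ 1 = expMap g.leviCivita p (show TangentSpace I p from v) := by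
    show maximalGeodesic g.leviCivita p (vT + (0 : ℝ) • wT) 1 = _
    rw [zero_smul, add_zero, ← expMap_eq_maximalGeodesic hc]
  rw [← key.trans rfl]
  rw [hS1] at *
  exact (val_congr_point (g := g) hγ1 _ _).symm


/-- **Polarised form**: in constant curvature `1`, for `v ≠ 0` and all `w, w'`,
`g(d(exp_p)_v w, d(exp_p)_v w') = g(w,v)g(w',v)/λ + (g(w,w') - g(w,v)g(w',v)/λ) sin²(√λ)/λ`,
`λ = g(v,v)` (both sides are symmetric bilinear forms in `(w, w')` agreeing on the diagonal by
`val_mfderiv_expMap_self_of_curvature_one`). Lee 2018, Prop. 10.12 and Thm. 10.14 (constant-curvature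
metrics in normal coordinates). [cite: Lee2018, Prop. 10.12 and Thm. 10.14] -/
theorem val_mfderiv_expMap_of_curvature_one (hg : g.IsRiemannian)
    (hK : g.HasConstantSectionalCurvatureWith g.leviCivita 1)
    (hcov₁ : g.leviCivita.IsLocallyContMDiff 1)
    (hc : IsGeodesicallyComplete g.leviCivita) (p : M) {v : E} (hv : v ≠ 0) (w w' : E) :
    g.val (expMap g.leviCivita p (show TangentSpace I p from v))
        (mfderiv 𝓘(ℝ, E) I (fun u : E ↦ expMap g.leviCivita p (show TangentSpace I p from u)) v w)
        (mfderiv 𝓘(ℝ, E) I (fun u : E ↦ expMap g.leviCivita p (show TangentSpace I p from u)) v w') =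
      g.val p (show TangentSpace I p from w) (show TangentSpace I p from v) *
            g.val p (show TangentSpace I p from w') (show TangentSpace I p from v) /
          g.val p (show TangentSpace I p from v) (show TangentSpace I p from v) +
        (g.val p (show TangentSpace I p from w) (show TangentSpace I p from w') -
            g.val p (show TangentSpace I p from w) (show TangentSpace I p from v) *
              g.val p (show TangentSpace I p from w') (show TangentSpace I p from v) /
              g.val p (show TangentSpace I p from v) (show TangentSpace I p from v)) /
          g.val p (show TangentSpace I p from v) (show TangentSpace I p from v) *
        Real.sin (Real.sqrt (g.val p (show TangentSpace I p from v)
          (show TangentSpace I p from v))) ^ 2 := by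
  have h1 := val_mfderiv_expMap_self_of_curvature_one (I := I) hg hK hcov₁ hc p hv w
  have h2 := val_mfderiv_expMap_self_of_curvature_one (I := I) hg hK hcov₁ hc p hv w'
  have h3 := val_mfderiv_expMap_self_of_curvature_one (I := I) hg hK hcov₁ hc p hv (w + w')
  set x := expMap g.leviCivita p (show TangentSpace I p from v) with hx
  set D := mfderiv 𝓘(ℝ, E) I (fun u : E ↦ expMap g.leviCivita p (show TangentSpace I p from u)) v
    with hD
  -- bilinearity in the `T_pM` slots (the vectors are read through `show TangentSpace I p from ·`)
  have r1 : g.val p (show TangentSpace I p from (w + w')) =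
      g.val p (show TangentSpace I p from w) + g.val p (show TangentSpace I p from w') :=
    map_add (g.val p) _ _
  have r2 : ∀ z : TangentSpace I p, g.val p z (show TangentSpace I p from (w + w')) =
      g.val p z (show TangentSpace I p from w) + g.val p z (show TangentSpace I p from w') :=
    fun z ↦ map_add (g.val p z) _ _
  have hadd : D (w + w') = D w + D w' := map_add D w w'
  rw [hadd] at h3
  simp only [map_add, add_apply, r1, r2] at h3
  have hs1 : g.val x (D w') (D w) = g.val x (D w) (D w') := g.symm x _ _
  have hs2 : g.val p (show TangentSpace I p from w') (show TangentSpace I p from w) =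
      g.val p (show TangentSpace I p from w) (show TangentSpace I p from w') := g.symm p _ _
  rw [hs1, hs2] at h3
  -- abbreviations
  set lam := g.val p (show TangentSpace I p from v) (show TangentSpace I p from v) with hlam
  have hlam0 : lam ≠ 0 := (hg p _ hv).ne'
  set σ := Real.sin (Real.sqrt lam) ^ 2 with hσ
  set A := g.val p (show TangentSpace I p from w) (show TangentSpace I p from v) with hA
  set B := g.val p (show TangentSpace I p from w') (show TangentSpace I p from v) with hB
  set C := g.val p (show TangentSpace I p from w) (show TangentSpace I p from w') with hC
  set P := g.val p (show TangentSpace I p from w) (show TangentSpace I p from w) with hP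
  set R := g.val p (show TangentSpace I p from w') (show TangentSpace I p from w') with hR
  have e : 2 * g.val x (D w) (D w') =
      g.val x (D w) (D w) + g.val x (D w) (D w') + (g.val x (D w) (D w') + g.val x (D w') (D w')) -
        g.val x (D w) (D w) - g.val x (D w') (D w') := by ring
  rw [h3, h1, h2] at e
  have key : 2 * g.val x (D w) (D w') = 2 * (A * B / lam + (C - A * B / lam) / lam * σ) := by
    rw [e]
    field_simp
    ring
  linarith

omit [Fact (1 ≤ n)] in
/-- **At `v = 0`**: `d(exp_p)_0 = id`, so `g(d(exp_p)_0 w, d(exp_p)_0 w') = g(w, w')`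
(`hasMFDerivAt_expMap_zero`). [cite: Lee2018, Prop. 5.19 (d)] -/
theorem val_mfderiv_expMap_zero (hc : IsGeodesicallyComplete g.leviCivita) (p : M) (w w' : E) :
    g.val (expMap g.leviCivita p (show TangentSpace I p from (0 : E)))
        (mfderiv 𝓘(ℝ, E) I (fun u : E ↦ expMap g.leviCivita p (show TangentSpace I p from u)) 0 w)
        (mfderiv 𝓘(ℝ, E) I (fun u : E ↦ expMap g.leviCivita p (show TangentSpace I p from u)) 0 w') =
      g.val p (show TangentSpace I p from w) (show TangentSpace I p from w') := by
  have h := (hasMFDerivAt_expMap_zero (I := I) hc p).mfderiv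
  have hw : mfderiv 𝓘(ℝ, E) I (fun u : E ↦ expMap g.leviCivita p (show TangentSpace I p from u))
      0 w = w := by rw [h]; rfl
  have hw' : mfderiv 𝓘(ℝ, E) I (fun u : E ↦ expMap g.leviCivita p (show TangentSpace I p from u))
      0 w' = w' := by rw [h]; rfl
  rw [hw, hw']
  exact val_congr_point (g := g) (expMap_zero (cov := g.leviCivita) p) w w'

/-- **Inside the ball of radius `π` the exponential map of a space of constant curvature `1` is
an immersion**: if `g(v, v) < π²` then `d(exp_p)_v` is injective (the first conjugate point along
a unit speed geodesic is at distance `π`; Lee 2018, Prop. 10.12 and Prop. 10.20). For `v ≠ 0`,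
`|d(exp_p)_v w|² = g(w,v)²/λ + (g(w,w) - g(w,v)²/λ) sin²(√λ)/λ` with `sin √λ ≠ 0`, and
`g(w,w) - g(w,v)²/λ ≥ 0` with equality iff `w ∥ v` (Cauchy–Schwarz). [cite: Lee2018, Prop. 10.20] -/
theorem mfderiv_expMap_injective_of_curvature_one (hg : g.IsRiemannian)
    (hK : g.HasConstantSectionalCurvatureWith g.leviCivita 1)
    (hcov₁ : g.leviCivita.IsLocallyContMDiff 1)
    (hc : IsGeodesicallyComplete g.leviCivita) (p : M) {v : E}
    (hv : g.val p (show TangentSpace I p from v) (show TangentSpace I p from v) < Real.pi ^ 2) :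
    Injective (mfderiv 𝓘(ℝ, E) I
      (fun u : E ↦ expMap g.leviCivita p (show TangentSpace I p from u)) v) := by
  by_cases hv0 : v = 0
  · subst hv0
    rw [(hasMFDerivAt_expMap_zero (I := I) hc p).mfderiv]
    exact fun a b h ↦ h
  rw [injective_iff_map_eq_zero]
  intro w hw
  have hQ := val_mfderiv_expMap_self_of_curvature_one (I := I) hg hK hcov₁ hc p hv0 w
  rw [hw] at hQ
  simp only [map_zero] at hQ
  set lam := g.val p (show TangentSpace I p from v) (show TangentSpace I p from v) with hlam
  set β := g.val p (show TangentSpace I p from w) (show TangentSpace I p from v) with hβ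
  set c := g.val p (show TangentSpace I p from w) (show TangentSpace I p from w) with hc'
  have hlampos : 0 < lam := hg p _ hv0
  -- `sin² √λ > 0`
  have hsin : 0 < Real.sin (Real.sqrt lam) ^ 2 := by
    have h1 : 0 < Real.sqrt lam := Real.sqrt_pos.2 hlampos
    have h2 : Real.sqrt lam < Real.pi := by
      rw [← Real.sqrt_sq Real.pi_pos.le]
      exact Real.sqrt_lt_sqrt hlampos.le hv
    exact pow_pos (Real.sin_pos_of_pos_of_lt_pi h1 h2) 2
  -- Cauchy–Schwarz for the positive definite `g_p`: `β² ≤ λ c`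
  have hnn : ∀ (x : M) (u : TangentSpace I x), 0 ≤ g.val x u u := fun x u ↦ by
    by_cases hu : u = 0
    · subst hu; simp
    · exact (hg x u hu).le
  have hCS : β ^ 2 ≤ lam * c := by
    -- `0 ≤ g(λ w - β v, λ w - β v) = λ (λ c - β²)`
    have h := hnn p (lam • (show TangentSpace I p from w) - β • (show TangentSpace I p from v))
    have hvw : g.val p (show TangentSpace I p from v) (show TangentSpace I p from w) = β := by
      rw [hβ]; exact g.symm p _ _
    simp only [map_sub, map_smul, sub_apply, smul_apply,
      smul_eq_mul, ← hlam, ← hβ, ← hc', hvw] at h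
    nlinarith
  -- from `Q(w) = 0`: `β = 0` and `c = β²/λ = 0`
  have hterm1 : 0 ≤ β ^ 2 / lam := div_nonneg (sq_nonneg _) hlampos.le
  have hterm2 : 0 ≤ (c - β ^ 2 / lam) := by
    rw [sub_nonneg, div_le_iff₀ hlampos]; nlinarith
  have hterm2' : 0 ≤ (c - β ^ 2 / lam) / lam * Real.sin (Real.sqrt lam) ^ 2 :=
    mul_nonneg (div_nonneg hterm2 hlampos.le) hsin.le
  have h0 : (c - β ^ 2 / lam) / lam * Real.sin (Real.sqrt lam) ^ 2 = 0 := by linarith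
  have hc0 : c - β ^ 2 / lam = 0 := by
    rcases mul_eq_zero.1 h0 with h | h
    · exact (div_eq_zero_iff.1 h).resolve_right hlampos.ne'
    · exact absurd h hsin.ne'
  have hβ0 : β ^ 2 / lam = 0 := by linarith
  have hcz : c = 0 := by linarith
  exact CartanHadamard.eq_zero_of_val_self_eq_zero hg p hcz

end Geometry

end Literature.Geometry.Riemannian
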